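import Summits.QuantumFields.BalabanUV.T4Continuum.Support.NE9VacuumSubtractedBridge

/-!
# NE9BridgeSizeInduction — the occupation binder `hocc` of the coupling-two-point ENDs DERIVED from one-run size data
(P2's size induction ported to the bridge; skeleton `t4/b2b-balaban-t4-ne9-p1/SKELETON-NE9-P1.md` leaf R2 / swarm item (w3);
cell `pub-balaban`, T4-DAG §2 node U3 / §6 NE9; lineage t4-ne9-p1 = prover P1, generation 21)

HONEST FRAMING (T4-DAG PAGE 1).  Rung (B)+1 on a FIXED finite torus with `FlowStep.BetaPertH` and (B) explicit — NOT infinite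
volume, NOT a mass gap, NOT the Clay problem.  NE9 is a cell NEW ESTIMATE, NOT PRINTED, NOT discharged here: bookkeeping over the
ABSTRACT carriers; every analytic input a DISPLAYED binder; [I] = [Balaban1987RG1], [II] = [Balaban1988RG2Cluster] quoted for
TYPES/STRUCTURE only (ABSOLUTE RULE).  BetaPertH, (B), (B^μ) do not occur.

WHY.  Both ENDs of this lineage — `NE9LastCouplingBridge.ne9_and_fadingMemory_of_couplingTwoPoint` (representation `hrepr`
with an explicit part) and `NE9VacuumSubtractedBridge.ne9_and_fadingMemory_of_couplingTwoPoint_vacSub` (vacuum-subtracted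
representation `hreprV`) — display the OCCUPATION binder `hocc : ρ k (T k g′ (E g)) ∈ 𝒜 k` (every occurring table, the hybrid
ones included, is admissible).  The sibling lineage P2 DERIVES it by strong induction on the creation step
(`T4HistoryLipschitzSegment.termSize_of_recursion`, §9) from ONE-RUN SIZE data of printed TYPE: (B0) the base size, (X) the size
of the table-independent part, (N) a size profile with `p₀ j + B₀ j ≤ N (j+1)` ([II] p. 21: «O(1)C₃ε₁ ≦ ½E₀» + the constant),
(R′) the read-out of the weighted output box of radius `sizeRadius τ N k` into `𝒜 k` ((1.36) box), plus the class-level channel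
size `ChannelSizeNN` (= `ChannelSizeAtStepNN` summed, `channelSizeNN_of_perStepNN`).  THIS LEAF plugs that derivation into both
ENDs, so that R2 is no longer a leaf of the owner's skeleton: for `hrepr` it is P2's theorem verbatim (the explicit part IS the
table-independent part); for `hreprV` the induction is re-run (`termSize_of_recursion_vacSub`), because the subtracted term
`Re newTerm(U₀)(ρ k P)` is NOT table-independent — at step k+1 the occurring table is admissible by the induction hypothesis
FIRST, then `|Ψ| ≤ 2B₀ k·e^{−κd} + |explZ|`.

WHAT IS PROVED (kernel, `[folklore]` bookkeeping).
§1 `termSize_of_recursion_vacSub`: `TermSize E W κ N ∧ (∀ g g′ ∈ W, ∀ k, ρ k (T k g′ (E g)) ∈ 𝒜 k)` from (B0), (XZ) `|explZ k U X|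
   ≤ e^{−κd}·p₀ k` on scale-(k+1) domains, (N′) `p₀ j + 2·B₀ j ≤ N (j+1)`, (R′), `ChannelSizeNN`, `Factorises`, `hreprV`,
   `TwoPointKP`, `DecayExtract`, `PinBudget`.
§2 `ne9_and_fadingMemory_of_couplingTwoPoint_sizeInduction`: the bridge END with `hocc` REPLACED by (B0), (X) (`|expl k (g k) U X|
   ≤ e^{−κd}·p₀ k`), (N), (R′) — and it also returns `TermSize E W κ N` (the (1.18)-type size bound of every term, DERIVED).
§3 `ne9_and_fadingMemory_of_couplingTwoPoint_vacSub_sizeInduction`: the same for the vacuum-subtracted END with (XZ), (N′).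
Nothing about [I]/[II] asserted; 0/9 unchanged.

References (TYPES only): [Balaban1987RG1] CMP 109 (1987) (0.23)–(0.25) pp. 256–257, (1.18) p. 263, (2.12)–(2.14) p. 268;
[Balaban1988RG2Cluster] CMP 116 (1988) (1.36) p. 9, (2.13)–(2.15) pp. 14–15, Lemma 3 (2.38) p. 20, (2.41) p. 21 and p. 21 text.
-/

noncomputable section

namespace Summit.QuantumFields.BalabanUV.T4Continuum.NE9BridgeSizeInduction

open scoped BigOperators
open Literature.Probability.LatticeModels
open Literature.MathematicalPhysics.QuantumFieldTheory.Balaban1983to89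
open Literature.MathematicalPhysics.QuantumFieldTheory.Balaban1983to89.T4OutputRate
open Literature.MathematicalPhysics.QuantumFieldTheory.Balaban1983to89.T4ActivityLipschitz
open Literature.MathematicalPhysics.QuantumFieldTheory.Balaban1983to89.T4HistoryLipschitzRecursion
open Literature.MathematicalPhysics.QuantumFieldTheory.Balaban1983to89.T4HistoryLipschitzOuter
open Literature.MathematicalPhysics.QuantumFieldTheory.Balaban1983to89.T4HistoryLipschitzActivity
open Literature.MathematicalPhysics.QuantumFieldTheory.Balaban1983to89.T4HistoryLipschitzActivity (ClusterGeom)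
open Literature.MathematicalPhysics.QuantumFieldTheory.Balaban1983to89.T4HistoryLipschitzSegment
open Summit.QuantumFields.BalabanUV.T4Continuum.NE9LastCouplingBridge
open Summit.QuantumFields.BalabanUV.T4Continuum.NE9VacuumSubtractedBridge

variable {C : Carriers} (G : ClusterGeom C) {Bg : Type} {Pot : Type*} [NormedAddCommGroup Pot]

/-! ## §1 The size induction under the vacuum-subtracted representation -/

/-- **SIZE INDUCTION, VACUUM-SUBTRACTED** (P2's `termSize_of_recursion` re-run for `hreprV`): from the admissible class, the
class-level channel size `ChannelSizeNN`, the factorisation, TWO-POINT KP ∧ decay ∧ pin budget, the representation `hreprV`, (B0)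
the base size, (XZ) the size `|explZ k U X| ≤ e^{−κd}·p₀ k` of the coupling-free part on scale-(k+1) domains, (N′) a nonnegative
profile with `p₀ j + 2·B₀ j ≤ N (j+1)` and (R′) the read-out of the weighted output box into `𝒜 k`: EVERY history obeys
`TermSize E W κ N` AND every occurring (hybrid) table is admissible.  Strong induction on the creation step; at step `k+1` the
occurring table is admissible by the hypothesis for the steps `≤ k`, then the new term at `U` and at `U₀` is pin-bounded
(`norm_newTerm_le_of_twoPointKP`). [cite: Balaban1987RG1, (0.23) p.256, (1.18) p.263, (2.14) p.268; Balaban1988RG2Cluster, (2.41) p.21 and p.21 text] -/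
theorem termSize_of_recursion_vacSub {ι : Type} {E : Functional C Bg} {W : Set (ℕ → ℝ)} {Adm : Set (Bg → C.Dom → ℝ)}
    {T : ℕ → (ℕ → ℝ) → (Bg → C.Dom → ℝ) → ι → ℝ} {Ψ : ℕ → ℝ → (ι → ℝ) → Bg → C.Dom → ℝ}
    {act : ℕ → ℝ → Bg → Pot → G.P → ℂ} {𝒜 : ℕ → Set Pot} {n : ℕ → ℝ → Bg → G.P → ℝ} {lip : ℕ → ℝ} {a d : G.P → ℝ}
    {δ : C.Dom → ℝ} {B₀ p₀ N : ℕ → ℝ} {κ : ℝ} {wt : ℕ → ι → ℝ} {τ : ℕ → ℕ → ℝ} (ρ : ℕ → (ι → ℝ) → Pot) (U₀ : Bg)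
    (explZ : ℕ → Bg → C.Dom → ℝ) (hAdm : AdmissibleTerms E W Adm) (hsize : ChannelSizeNN Adm T κ wt τ)
    (hfac : Factorises E W T Ψ) (hK : TwoPointKP G W act 𝒜 n lip a d) (hdec : G.DecayExtract δ d)
    (hpin : G.PinBudget a δ B₀ κ)
    (hreprV : ∀ (k : ℕ) (s : ℝ) (P : ι → ℝ) (U : Bg) (X : C.Dom),
      Ψ k s P U X = (G.newTerm act k s U X (ρ k P)).re - (G.newTerm act k s U₀ X (ρ k P)).re + explZ k U X)
    (hexplZ : ∀ (k : ℕ) (U : Bg) (X : C.Dom), C.scale X = k + 1 → |explZ k U X| ≤ Real.exp (-(κ * C.d X)) * p₀ k)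
    (hbase : ∀ g ∈ W, ∀ (U : Bg) (X : C.Dom), C.scale X = 0 → |E g U X| ≤ Real.exp (-(κ * C.d X)) * N 0)
    (hNsucc : ∀ j, p₀ j + 2 * B₀ j ≤ N (j + 1)) (hNnn : ∀ j, 0 ≤ N j)
    (hbox : ∀ (k : ℕ) (P : ι → ℝ), (∀ y, |P y| ≤ wt k y * sizeRadius τ N k) → ρ k P ∈ 𝒜 k) :
    TermSize E W κ N ∧ ∀ g ∈ W, ∀ g' ∈ W, ∀ k : ℕ, ρ k (T k g' (E g)) ∈ 𝒜 k := by
  have main : ∀ (m : ℕ), ∀ g ∈ W, ∀ (U : Bg) (X : C.Dom), C.scale X ≤ m →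
      |E g U X| ≤ Real.exp (-(κ * C.d X)) * N (C.scale X) := by
    intro m
    induction m with
    | zero =>
        intro g hg U X hX
        have h0 : C.scale X = 0 := Nat.le_zero.mp hX
        rw [h0]
        exact hbase g hg U X h0
    | succ k ih =>
        intro g hg U X hX
        rcases Nat.lt_or_ge (C.scale X) (k + 1) with hlt | hge
        · exact ih g hg U X (Nat.lt_succ_iff.mp hlt)
        · have hXk : C.scale X = k + 1 := le_antisymm hX hge
          have hocc : ρ k (T k g (E g)) ∈ 𝒜 k :=
            hbox k _ fun y => hsize k g (E g) (hAdm.1 g hg) N hNnn (fun U' X' hX' => ih g hg U' X' hX') y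
          have hnew : ∀ V : Bg, |(G.newTerm act k (g k) V X (ρ k (T k g (E g)))).re| ≤ B₀ k * Real.exp (-(κ * C.d X)) :=
            fun V => (Complex.abs_re_le_norm _).trans (norm_newTerm_le_of_twoPointKP G hK hdec hpin hg hXk (U := V) hocc)
          have he := hexplZ k U X hXk
          rw [hfac g hg k U X hXk, hXk, hreprV]
          calc |(G.newTerm act k (g k) U X (ρ k (T k g (E g)))).re - (G.newTerm act k (g k) U₀ X (ρ k (T k g (E g)))).re +
                  explZ k U X|
              ≤ |(G.newTerm act k (g k) U X (ρ k (T k g (E g)))).re - (G.newTerm act k (g k) U₀ X (ρ k (T k g (E g)))).re| +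
                  |explZ k U X| := abs_add_le _ _
            _ ≤ (|(G.newTerm act k (g k) U X (ρ k (T k g (E g)))).re| +
                  |(G.newTerm act k (g k) U₀ X (ρ k (T k g (E g)))).re|) + |explZ k U X| :=
                add_le_add (abs_sub _ _) le_rfl
            _ ≤ (B₀ k * Real.exp (-(κ * C.d X)) + B₀ k * Real.exp (-(κ * C.d X))) + Real.exp (-(κ * C.d X)) * p₀ k :=
                add_le_add (add_le_add (hnew U) (hnew U₀)) he
            _ = Real.exp (-(κ * C.d X)) * (p₀ k + 2 * B₀ k) := by ring
            _ ≤ Real.exp (-(κ * C.d X)) * N (k + 1) := mul_le_mul_of_nonneg_left (hNsucc k) (Real.exp_nonneg _)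
  have hT : TermSize E W κ N := fun g hg U X => main (C.scale X) g hg U X le_rfl
  exact ⟨hT, fun g hg g' _ k => hbox k _ fun y => hsize k g' (E g) (hAdm.1 g hg) N hNnn (fun U X _ => hT g hg U X) y⟩

/-! ## §2 The bridge END with the occupation DERIVED -/

/-- **NE9 ∧ FADING MEMORY ∧ THE TERM SIZE BOUND, occupation DERIVED (representation with an explicit part)** —
`NE9LastCouplingBridge.ne9_and_fadingMemory_of_couplingTwoPoint` with `hocc` REPLACED by P2's size-induction data: (B0) `hbase`,
(X) `hexplSize : |expl k (g k) U X| ≤ e^{−κd}·p₀ k`, (N) `hNsucc : p₀ j + B ≤ N (j+1)`, `hNnn`, (R′) `hbox` (the weighted output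
box of radius `sizeRadius τ N k` is read into `𝒜 k`); the class-level channel size is `channelSizeNN_of_perStepNN hres hsum hstep`.
Returns in addition `TermSize E W κ N` ([I] (1.18)-TYPE size of every term, DERIVED). [cite: Balaban1987RG1, (1.18) p.263 and (2.12)-(2.14) p.268; Balaban1988RG2Cluster, (1.36) p.9, Lemma 3 (2.38) p.20, (2.41) p.21] -/
theorem ne9_and_fadingMemory_of_couplingTwoPoint_sizeInduction [NormedSpace ℂ Pot] {ι : Type} {E : Functional C Bg}
    {W : Set (ℕ → ℝ)} {Adm : Set (Bg → C.Dom → ℝ)} {T : ℕ → (ℕ → ℝ) → (Bg → C.Dom → ℝ) → ι → ℝ}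
    {Ψ : ℕ → ℝ → (ι → ℝ) → Bg → C.Dom → ℝ} {act : ℕ → ℝ → Bg → Pot → G.P → ℂ} {𝒜 : ℕ → Set Pot}
    {n : ℕ → ℝ → Bg → G.P → ℝ} {lip clip : ℕ → ℝ} {a d : G.P → ℝ} {δ : C.Dom → ℝ}
    {κ B lipbar clipbar pexbar qTbar τbar ω : ℝ} {wt : ℕ → ι → ℝ} {τ : ℕ → ℕ → ℝ} {pex qT p₀ N : ℕ → ℝ}
    (ρ : ℕ → (ι → ℝ) → Pot) (expl : ℕ → ℝ → Bg → C.Dom → ℝ) (h0 : ScaleZeroFree E W)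
    (hAdm : AdmissibleTerms E W Adm) (hres : AdmRestrict Adm) (hadd : ChannelAdditive Adm T)
    (hsum : ChannelStepSum Adm T) (hstep : ChannelSizeAtStepNN Adm T κ wt τ) (hfac : Factorises E W T Ψ)
    (hclip0 : ∀ k, 0 ≤ clip k)
    (hCup : ∀ g ∈ W, ∀ g' ∈ W, ∀ (k : ℕ) (U : Bg) (X : C.Dom), C.scale X = k + 1 → ∀ Q ∈ 𝒜 k, ∀ γ ∈ G.vol X,
      ‖act k (g k) U Q γ‖ ≤ n k (g' k) U γ ∧
        ‖act k (g k) U Q γ - act k (g' k) U Q γ‖ ≤ clip k * |g k - g' k| * n k (g' k) U γ)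
    (hqT0 : ∀ k, 0 ≤ qT k)
    (hTcup : ∀ g ∈ W, ∀ g' ∈ W, ∀ (k : ℕ) (y : ι), |T k g (E g) y - T k g' (E g) y| ≤ wt k y * (qT k * |g k - g' k|))
    (hrepr : ∀ (k : ℕ) (s : ℝ) (P : ι → ℝ) (U : Bg) (X : C.Dom),
      Ψ k s P U X = (G.newTerm act k s U X (ρ k P)).re + expl k s U X)
    (hexpl : ∀ g ∈ W, ∀ g' ∈ W, ∀ (k : ℕ) (U : Bg) (X : C.Dom), C.scale X = k + 1 →
      |expl k (g k) U X - expl k (g' k) U X| ≤ Real.exp (-(κ * C.d X)) * (pex k * |g k - g' k|))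
    (hclipb : ∀ k, clip k ≤ clipbar) (hpexb : ∀ k, pex k ≤ pexbar) (hpexbar : 0 ≤ pexbar) (hqTb : ∀ k, qT k ≤ qTbar)
    (hK : TwoPointKP G W act 𝒜 n lip a d) (hdec : G.DecayExtract δ d) (hpin : G.PinBudget a δ (fun _ => B) κ)
    (hρ : ∀ (k : ℕ) (P P' : ι → ℝ) (M : ℝ), (∀ y, |P y - P' y| ≤ wt k y * M) → ‖ρ k P - ρ k P'‖ ≤ M)
    -- the size-induction data (B0), (X), (N), (R′) — in place of the occupation hypothesis `hocc`
    (hexplSize : ∀ g ∈ W, ∀ (k : ℕ) (U : Bg) (X : C.Dom), C.scale X = k + 1 →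
      |expl k (g k) U X| ≤ Real.exp (-(κ * C.d X)) * p₀ k)
    (hbase : ∀ g ∈ W, ∀ (U : Bg) (X : C.Dom), C.scale X = 0 → |E g U X| ≤ Real.exp (-(κ * C.d X)) * N 0)
    (hNsucc : ∀ j, p₀ j + B ≤ N (j + 1)) (hNnn : ∀ j, 0 ≤ N j)
    (hbox : ∀ (k : ℕ) (P : ι → ℝ), (∀ y, |P y| ≤ wt k y * sizeRadius τ N k) → ρ k P ∈ 𝒜 k)
    (hB : 0 ≤ B) (hlipb : ∀ k, lip k ≤ lipbar) (hτbar : 0 ≤ τbar) (hω : 0 ≤ ω) (hpos : 0 < ω + 4 * lipbar * B * τbar)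
    (hτ : ∀ k j, j ≤ k → 0 ≤ τ k j ∧ τ k j ≤ τbar * ω ^ (k - j)) :
    TermSize E W κ N ∧
      NE9 E W κ (prodModuli (4 * clipbar * B + pexbar + 4 * lipbar * B * qTbar) fun _ => ω + 4 * lipbar * B * τbar) ∧
        FadingMemory ((4 * clipbar * B + pexbar + 4 * lipbar * B * qTbar) / (ω + 4 * lipbar * B * τbar))
          (ω + 4 * lipbar * B * τbar)
          (prodModuli (4 * clipbar * B + pexbar + 4 * lipbar * B * qTbar) fun _ => ω + 4 * lipbar * B * τbar) := by
  have hexplS : ∀ g ∈ W, ∀ (k : ℕ) (P : ι → ℝ) (U : Bg) (X : C.Dom), C.scale X = k + 1 →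
      |Ψ k (g k) P U X - (G.newTerm act k (g k) U X (ρ k P)).re| ≤ Real.exp (-(κ * C.d X)) * p₀ k := by
    intro g hg k P U X hX
    rw [hrepr, add_sub_cancel_left]
    exact hexplSize g hg k U X hX
  obtain ⟨hT, hocc⟩ := termSize_of_recursion G ρ hAdm (channelSizeNN_of_perStepNN hres hsum hstep) hfac hK hdec hpin
    hexplS hbase hNsucc hNnn hbox
  exact ⟨hT, ne9_and_fadingMemory_of_couplingTwoPoint G ρ expl h0 hAdm hres hadd hsum hstep hfac hclip0 hCup hqT0 hTcup hrepr
    hexpl hclipb hpexb hpexbar hqTb hK hdec hpin hρ hocc hB hlipb hτbar hω hpos hτ⟩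

/-! ## §3 The vacuum-subtracted END with the occupation DERIVED -/

/-- **NE9 ∧ FADING MEMORY ∧ THE TERM SIZE BOUND, occupation DERIVED (vacuum-subtracted representation)** —
`NE9VacuumSubtractedBridge.ne9_and_fadingMemory_of_couplingTwoPoint_vacSub` with `hocc` REPLACED by (B0) `hbase`, (XZ)
`|explZ k U X| ≤ e^{−κd}·p₀ k`, (N′) `p₀ j + 2B ≤ N (j+1)`, `hNnn`, (R′) `hbox`.  After this theorem the two coupling-two-point ENDs
of the lineage display NEITHER an explicit-part modulus NOR an occupation hypothesis. [cite: Balaban1987RG1, (1.18) p.263 and (2.12)-(2.14) p.268; Balaban1988RG2Cluster, (1.36) p.9, Lemma 3 (2.38) p.20, (2.41) p.21] -/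
theorem ne9_and_fadingMemory_of_couplingTwoPoint_vacSub_sizeInduction [NormedSpace ℂ Pot] {ι : Type} {E : Functional C Bg}
    {W : Set (ℕ → ℝ)} {Adm : Set (Bg → C.Dom → ℝ)} {T : ℕ → (ℕ → ℝ) → (Bg → C.Dom → ℝ) → ι → ℝ}
    {Ψ : ℕ → ℝ → (ι → ℝ) → Bg → C.Dom → ℝ} {act : ℕ → ℝ → Bg → Pot → G.P → ℂ} {𝒜 : ℕ → Set Pot}
    {n : ℕ → ℝ → Bg → G.P → ℝ} {lip clip : ℕ → ℝ} {a d : G.P → ℝ} {δ : C.Dom → ℝ}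
    {κ B lipbar clipbar qTbar τbar ω : ℝ} {wt : ℕ → ι → ℝ} {τ : ℕ → ℕ → ℝ} {qT p₀ N : ℕ → ℝ}
    (ρ : ℕ → (ι → ℝ) → Pot) (U₀ : Bg) (explZ : ℕ → Bg → C.Dom → ℝ) (h0 : ScaleZeroFree E W)
    (hAdm : AdmissibleTerms E W Adm) (hres : AdmRestrict Adm) (hadd : ChannelAdditive Adm T)
    (hsum : ChannelStepSum Adm T) (hstep : ChannelSizeAtStepNN Adm T κ wt τ) (hfac : Factorises E W T Ψ)
    (hclip0 : ∀ k, 0 ≤ clip k)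
    (hCup : ∀ g ∈ W, ∀ g' ∈ W, ∀ (k : ℕ) (U : Bg) (X : C.Dom), C.scale X = k + 1 → ∀ Q ∈ 𝒜 k, ∀ γ ∈ G.vol X,
      ‖act k (g k) U Q γ‖ ≤ n k (g' k) U γ ∧
        ‖act k (g k) U Q γ - act k (g' k) U Q γ‖ ≤ clip k * |g k - g' k| * n k (g' k) U γ)
    (hqT0 : ∀ k, 0 ≤ qT k)
    (hTcup : ∀ g ∈ W, ∀ g' ∈ W, ∀ (k : ℕ) (y : ι), |T k g (E g) y - T k g' (E g) y| ≤ wt k y * (qT k * |g k - g' k|))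
    (hreprV : ∀ (k : ℕ) (s : ℝ) (P : ι → ℝ) (U : Bg) (X : C.Dom),
      Ψ k s P U X = (G.newTerm act k s U X (ρ k P)).re - (G.newTerm act k s U₀ X (ρ k P)).re + explZ k U X)
    (hclipb : ∀ k, clip k ≤ clipbar) (hqTb : ∀ k, qT k ≤ qTbar)
    (hK : TwoPointKP G W act 𝒜 n lip a d) (hdec : G.DecayExtract δ d) (hpin : G.PinBudget a δ (fun _ => B) κ)
    (hρ : ∀ (k : ℕ) (P P' : ι → ℝ) (M : ℝ), (∀ y, |P y - P' y| ≤ wt k y * M) → ‖ρ k P - ρ k P'‖ ≤ M)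
    -- the size-induction data (B0), (XZ), (N′), (R′) — in place of the occupation hypothesis `hocc`
    (hexplZ : ∀ (k : ℕ) (U : Bg) (X : C.Dom), C.scale X = k + 1 → |explZ k U X| ≤ Real.exp (-(κ * C.d X)) * p₀ k)
    (hbase : ∀ g ∈ W, ∀ (U : Bg) (X : C.Dom), C.scale X = 0 → |E g U X| ≤ Real.exp (-(κ * C.d X)) * N 0)
    (hNsucc : ∀ j, p₀ j + 2 * B ≤ N (j + 1)) (hNnn : ∀ j, 0 ≤ N j)
    (hbox : ∀ (k : ℕ) (P : ι → ℝ), (∀ y, |P y| ≤ wt k y * sizeRadius τ N k) → ρ k P ∈ 𝒜 k)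
    (hB : 0 ≤ B) (hlipb : ∀ k, lip k ≤ lipbar) (hτbar : 0 ≤ τbar) (hω : 0 ≤ ω) (hpos : 0 < ω + 8 * lipbar * B * τbar)
    (hτ : ∀ k j, j ≤ k → 0 ≤ τ k j ∧ τ k j ≤ τbar * ω ^ (k - j)) :
    TermSize E W κ N ∧
      NE9 E W κ (prodModuli (8 * clipbar * B + 8 * lipbar * B * qTbar) fun _ => ω + 8 * lipbar * B * τbar) ∧
        FadingMemory ((8 * clipbar * B + 8 * lipbar * B * qTbar) / (ω + 8 * lipbar * B * τbar))
          (ω + 8 * lipbar * B * τbar)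
          (prodModuli (8 * clipbar * B + 8 * lipbar * B * qTbar) fun _ => ω + 8 * lipbar * B * τbar) := by
  obtain ⟨hT, hocc⟩ := termSize_of_recursion_vacSub G ρ U₀ explZ hAdm (channelSizeNN_of_perStepNN hres hsum hstep) hfac hK
    hdec hpin hreprV hexplZ hbase hNsucc hNnn hbox
  exact ⟨hT, ne9_and_fadingMemory_of_couplingTwoPoint_vacSub G ρ U₀ explZ h0 hAdm hres hadd hsum hstep hfac hclip0 hCup hqT0
    hTcup hreprV hclipb hqTb hK hdec hpin hρ hocc hB hlipb hτbar hω hpos hτ⟩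

end Summit.QuantumFields.BalabanUV.T4Continuum.NE9BridgeSizeInduction

end
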